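import Summits.BirchSwinnertonDyer.BirchSwinnertonDyer.Theorems.GoldfeldK12AdditiveTwoInertSevenKrizLi7Twist
import Summits.BirchSwinnertonDyer.Rank1Residual.X12.O11.RouteUEulerCriterionNat
import HarnessLib

set_option linter.dupNamespace false -- namespace `…BirchSwinnertonDyer.BirchSwinnertonDyer…` is the cell's (D-0017 nested layout)
set_option autoImplicit false

/-!
# K12₂″, the 7-INERT half — the GENERIC certificate kit of the Kriz–Li-on-the-twist rung: the two `‖B_{1,θ}‖₇ = 1`
# hypotheses of the class theorems from TWO INTEGER IDENTITIES (variable `n`, `r`)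

Cell `bsd-goldfeld`, seat `bsd-goldfeld-s1p-c201` (prover, gen 9); planner ruling (lvii)(3). `--supports` stmt-BirchSwinnertonDyer-20044
(K12₂″; registered stub `stub_inertHalfGenusNonTorsion` of skeleton v7.4). THESES-FREE. The class theorems of
`…GoldfeldK12AdditiveTwoInertSevenKrizLi7Twist` (p495876: (K) `not_isOfFinAddOrder_heegnerPoint_twist_cm7_even_of_thm120`, (C′)
`rankOneTwoConverse_twist_cm7_even_of_thm120`, (≤) `analyticRank_le_one_…`) take the two Kriz–Li unit conditions as the binders
`hcert₁` (every character `θ₁` mod `7·4n` with values `χ_{−4n}(j)·ω(j)⁴` has `‖B_{1,θ₁}‖₇ = 1`) and `hcert₂` (every `θ₂` mod `7·4n·r`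
with values `χ_{−4n}(j)·(j/r)·ω(j)` has `‖B_{1,θ₂}‖₇ = 1`). The member files (`…Member29/53/113/470`) prove them per `n` from
`decide +kernel` evaluations of the integers `S₁ = Σ_{j<28n} χ_{−4n}(j) j²⁹` and `S₂ = Σ_{j<28nr} χ_{−4n}(j)(j/r) j⁸` by repeating a
20-line argument each time. This file does that argument ONCE, for variable `n`, `r` and any computable integer-valued spelling `f`
of the Kronecker values `[j odd]·(−n/j)`:

* `hcert₁_twist_of_sum` — `hcert₁` from `hf : ∀ a, [a odd]·(−n/a) = f a`, `f (28n − 1) = −1` (the value at `−1`: `χ_{−4n}` is odd),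
  `ord₇(28n) = 1` and ONE integer identity `Σ_{j<28n} f(j) j²⁹ = S₁` with `7 ∥ S₁`;
* `hcert₂_twist_of_sum` — `hcert₂` from the same `hf`, a prime `r ≠ 7` (any `r` with `ord₇(28nr) = 1`), the value
  `f(28nr − 1)·((28nr − 1)/r) = 1` at `−1` and ONE identity `Σ_{j<28nr} f(j)(j/r) j⁸ = S₂` with `7 ∥ S₂`;
* `rankOneTwoConverse_twist_cm7_even_of_sums` — (C′) K12₂″ OUTRIGHT for the globally minimal models of `49a1^{(−4n)}` from the
  arithmetic side conditions of the class theorem and the two identities (members become one-line instances: the Kronecker spelling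
  `f`, its reciprocity lemma, the block sums).
Washington §5.1 / Thm 4.2 behind the tree's `norm_generalizedBernoulli_one_eq_one_of_cert_range` (bsd-cm, cell `Rank1Residual` Route U);
`θ ≠ 1` from the value at `j = −1` (`ω(−1)⁴ = 1`, resp. `‖ω(6) − 6‖₇ < 1` for a Teichmüller `ω`). HONEST FRAMING: certificate plumbing at
`p = 7`; nothing about `p = 2`; K12₂″ stays OPEN; BSD is not proved by any of this. THEOREMS ONLY. PARTITION: none — RANK axis (S1⁺).

References: [KrizLi2019] Thm. 1.20 (pp. 7–8), §1.5 (1); [Washington1997] §5.1, Thm. 4.2; [Cox2013] §1.C Lemma 1.14.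
-/

noncomputable section

open scoped Classical NumberTheorySymbols

open NumberField WeierstrassCurve DirichletCharacter
open Literature.NumberTheory.EllipticCurves Literature.NumberTheory.EllipticCurves.Rank1Residual
open Literature.NumberTheory.EllipticCurves.KrizLi2019 Literature.NumberTheory.LFunctions
open Literature.NumberTheory.EllipticCurves.ModularForms
open Literature.NumberTheory.QuadraticFields
open Summit.BirchSwinnertonDyer.Rank1Residual
open Summit.BirchSwinnertonDyer.Rank1Residual.X12.O11.RouteU

namespace Summit.BirchSwinnertonDyer.BirchSwinnertonDyer.Theorems.GoldfeldGoodTwists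

/-! ## §0 The residue `−1` of a level divisible by `7` -/

/-- For `L = 7k` with `k ≠ 0`: `(L − 1 : ZMod L).val = L − 1`, `L − 1` is a unit mod `L`, and `L − 1 ≡ 6 (mod 7)`. [folklore] -/
theorem val_pred_level {L : ℕ} [NeZero L] : (((L - 1 : ℕ)) : ZMod L).val = L - 1 := by
  rw [ZMod.val_natCast, Nat.mod_eq_of_lt (Nat.sub_lt (Nat.pos_of_ne_zero (NeZero.ne L)) one_pos)]

/-- `L − 1` is a unit modulo `L`. [folklore] -/
theorem isUnit_pred_level {L : ℕ} [NeZero L] : IsUnit ((((L - 1 : ℕ)) : ZMod L)) := by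
  rw [ZMod.isUnit_iff_coprime]
  have hL : 1 ≤ L := Nat.pos_of_ne_zero (NeZero.ne L)
  -- `gcd(L − 1, L) = gcd(L − 1, 1) = 1`
  have : Nat.Coprime (L - 1) (L - 1 + 1) := (Nat.coprime_self_add_right).mpr (Nat.coprime_one_right _)
  rwa [Nat.sub_add_cancel hL] at this

/-- `7k − 1 ≡ 6 (mod 7)`. [folklore] -/
theorem pred_level_cast_seven {L : ℕ} (h7 : 7 ∣ L) (hL : L ≠ 0) :
    ((((L - 1 : ℕ)) : ZMod 7)) = ((6 : ℕ) : ZMod 7) := by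
  rw [ZMod.natCast_eq_natCast_iff']
  obtain ⟨k, rfl⟩ := h7
  omega

/-! ## §1 `hcert₁` from one integer identity -/

/-- **`hcert₁` of the class theorems from ONE integer identity.** For `n ≠ 0`, an integer-valued spelling `f` of the Kronecker values
(`hf : [a odd]·(−n/a) = f a`), `ord₇(7·4n) = 1`, the value `f(28n − 1) = −1` and `Σ_{j<28n} f(j)·j²⁹ = S₁` with `7 ∣ S₁`, `49 ∤ S₁`:
every character `θ₁` mod `7·4n` with values `χ_{−4n}(j)·ω(j)⁴` (`ω` Teichmüller) has `‖B_{1,θ₁}‖₇ = 1`.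
[cite: KrizLi2019, Thm. 1.20 (p. 8) and §1.5 (1)] [cite: Washington1997, §5.1 and Thm. 4.2] -/
theorem hcert₁_twist_of_sum {n : ℕ} [NeZero n] (f : ℕ → ℤ)
    (hf : ∀ a : ℕ, (if Even a then (0 : ℤ) else J(-(n : ℤ) | a)) = f a)
    (hlev : padicValNat 7 (7 * (4 * n)) = 1) (hlast : f (7 * (4 * n) - 1) = -1)
    (S : ℤ) (hS : ∑ j ∈ Finset.range (7 * (4 * n)), f j * (j : ℤ) ^ (28 + 1) = S)
    (h1 : (7 : ℤ) ∣ S) (h2 : ¬ (7 : ℤ) ^ 2 ∣ S) :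
    ∀ (ω : DirichletCharacter ℚ_[7] 7), IsTeichmullerCharacter ω →
      ∀ θ : DirichletCharacter ℚ_[7] (7 * (4 * n)),
        (∀ j : ZMod (7 * (4 * n)), θ j =
          ((if Even j.val then (0 : ℤ) else J(-(n : ℤ) | j.val) : ℤ) : ℚ_[7]) * ω (j.val : ZMod 7) ^ 4) →
        ‖generalizedBernoulli 1 θ‖ = 1 := by
  intro ω hω θ hθ
  haveI : Fact (Nat.Prime 7) := ⟨by norm_num⟩
  haveI : NeZero (7 * (4 * n)) := ⟨by have := NeZero.ne n; positivity⟩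
  have hθ' : ∀ j : ZMod (7 * (4 * n)), θ j = ((f j.val : ℤ) : ℚ_[7]) * ω (j.val : ZMod 7) ^ 4 :=
    fun j => by rw [hθ j, hf]
  have hθ1 : θ ≠ 1 := by
    intro h1
    have hv := hθ' (((7 * (4 * n) - 1 : ℕ)) : ZMod (7 * (4 * n)))
    rw [h1, val_pred_level, MulChar.one_apply isUnit_pred_level,
      pred_level_cast_seven (dvd_mul_right 7 _) (NeZero.ne _), apply_neg_one_pow_four, mul_one, hlast] at hv
    norm_num at hv
  refine norm_generalizedBernoulli_one_eq_one_of_cert_range θ hθ1 hlev f 28 (fun j => ?_) S hS h1 h2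
  have := norm_sub_le_of_values ω hω θ f 4 (by norm_num) hθ' j
  simpa using this

/-! ## §2 `hcert₂` from one integer identity -/

/-- **`hcert₂` of the class theorems from ONE integer identity.** For `n ≠ 0`, `r ≠ 0`, the spelling `f` as above,
`ord₇(7·4n·r) = 1`, the value `f(28nr − 1)·((28nr − 1)/r) = 1` and `Σ_{j<28nr} f(j)(j/r)·j⁸ = S₂` with `7 ∣ S₂`, `49 ∤ S₂`: every
character `θ₂` mod `7·4n·r` with values `χ_{−4n}(j)·(j/r)·ω(j)` has `‖B_{1,θ₂}‖₇ = 1`.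
[cite: KrizLi2019, Thm. 1.20 (p. 8) and §1.5 (1)] [cite: Washington1997, §5.1 and Thm. 4.2] -/
theorem hcert₂_twist_of_sum {n r : ℕ} [NeZero n] [NeZero r] (f : ℕ → ℤ)
    (hf : ∀ a : ℕ, (if Even a then (0 : ℤ) else J(-(n : ℤ) | a)) = f a)
    (hlev : padicValNat 7 (7 * (4 * n) * r) = 1)
    (hlast : f (7 * (4 * n) * r - 1) * J(((7 * (4 * n) * r - 1 : ℕ) : ℤ) | r) = 1)
    (S : ℤ) (hS : ∑ j ∈ Finset.range (7 * (4 * n) * r), (f j * J((j : ℤ) | r)) * (j : ℤ) ^ (7 + 1) = S)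
    (h1 : (7 : ℤ) ∣ S) (h2 : ¬ (7 : ℤ) ^ 2 ∣ S) :
    ∀ (ω : DirichletCharacter ℚ_[7] 7), IsTeichmullerCharacter ω →
      ∀ θ : DirichletCharacter ℚ_[7] (7 * (4 * n) * r),
        (∀ j : ZMod (7 * (4 * n) * r), θ j =
          (((if Even j.val then (0 : ℤ) else J(-(n : ℤ) | j.val)) * J((j.val : ℤ) | r) : ℤ) : ℚ_[7]) *
            ω (j.val : ZMod 7) ^ 1) →
        ‖generalizedBernoulli 1 θ‖ = 1 := by
  intro ω hω θ hθ
  haveI : Fact (Nat.Prime 7) := ⟨by norm_num⟩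
  haveI : NeZero (7 * (4 * n) * r) := ⟨by have := NeZero.ne n; have := NeZero.ne r; positivity⟩
  have hθ' : ∀ j : ZMod (7 * (4 * n) * r), θ j = ((f j.val * J((j.val : ℤ) | r) : ℤ) : ℚ_[7]) * ω (j.val : ZMod 7) ^ 1 :=
    fun j => by rw [hθ j, hf]
  have hθ1 : θ ≠ 1 := by
    intro h1
    have hv := hθ' (((7 * (4 * n) * r - 1 : ℕ)) : ZMod (7 * (4 * n) * r))
    rw [h1, val_pred_level, MulChar.one_apply isUnit_pred_level, pow_one, hlast, Int.cast_one, one_mul,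
      pred_level_cast_seven (dvd_mul_of_dvd_left (dvd_mul_right 7 _) _) (NeZero.ne _)] at hv
    -- `ω(−1) = 1` contradicts `‖ω(6) − 6‖ < 1`
    have h6 : ((6 : ℕ) : ZMod 7) = ((6 : ℤ) : ZMod 7) := by norm_num
    rw [h6] at hv
    have hT := hω 6 (by decide)
    rw [← hv] at hT
    have : ‖(1 : ℚ_[7]) - ((6 : ℤ) : ℚ_[7])‖ = 1 := by
      rw [show (1 : ℚ_[7]) - ((6 : ℤ) : ℚ_[7]) = -((5 : ℕ) : ℚ_[7]) by norm_num, norm_neg]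
      exact Padic.norm_natCast_eq_one_iff.mpr (by decide)
    rw [this] at hT
    exact lt_irrefl _ hT
  refine norm_generalizedBernoulli_one_eq_one_of_cert_range θ hθ1 hlev (fun j => f j * J((j : ℤ) | r)) 7
    (fun j => ?_) S hS h1 h2
  have := norm_sub_le_of_values ω hω θ (fun j => f j * J((j : ℤ) | r)) 1 le_rfl hθ' j
  simpa using this

/-! ## §3 (C′) of the class file from the two identities: members become one-line instances -/

/-- **K12₂″ OUTRIGHT on the globally minimal models of `49a1^{(−4n)}` from TWO INTEGER IDENTITIES** (the class theorem (C′)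
`rankOneTwoConverse_twist_cm7_even_of_thm120` with its `hcert₁`, `hcert₂` supplied by §1–§2): arithmetic side conditions of the
double-unit locus (`n ≡ 1, 2 (mod 4)` squarefree, `7 ∤ n`; Heegner prime `r ≡ 7 (mod 8)`, `r ≠ 7`, coprime to `n`, `7` and the odd
primes of `n` split in `ℚ(√−r)`), a computable spelling `f` of `χ_{−4n}` on odd integers, and the two certificate sums with `7 ∥ S₁`,
`7 ∥ S₂`. Print binders: KL19 Thm. 1.20, Modularity, Gross–Zagier, Heegner rationality, `2`-parity.
[cite: KrizLi2019, Thm. 1.20 (pp. 7–8) and Rem. 1.21] [cite: GrossZagier1986, I.(6.3) and I.§7] [cite: DokchitserDokchitserAnnals2010, Thm. 1.4] -/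
theorem rankOneTwoConverse_twist_cm7_even_of_sums {n r : ℕ} [NeZero n] [hr : Fact r.Prime]
    (hn4 : n % 4 = 1 ∨ n % 4 = 2) (hsq : Squarefree n) (h7n : ¬ 7 ∣ n)
    (hr8 : r % 8 = 7) (hr7 : r ≠ 7) (hrn : r.Coprime n)
    (h7split : legendreSym 7 (-(r : ℤ)) = 1)
    (hsplit : ∀ q : ℕ, q.Prime → q ∣ n → q ≠ 2 → J(-(r : ℤ) | q) = 1)
    (f : ℕ → ℤ) (hf : ∀ a : ℕ, (if Even a then (0 : ℤ) else J(-(n : ℤ) | a)) = f a)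
    (hlev₁ : padicValNat 7 (7 * (4 * n)) = 1) (hlast₁ : f (7 * (4 * n) - 1) = -1)
    (S₁ : ℤ) (hS₁ : ∑ j ∈ Finset.range (7 * (4 * n)), f j * (j : ℤ) ^ (28 + 1) = S₁)
    (h1₁ : (7 : ℤ) ∣ S₁) (h2₁ : ¬ (7 : ℤ) ^ 2 ∣ S₁)
    (hlev₂ : padicValNat 7 (7 * (4 * n) * r) = 1)
    (hlast₂ : f (7 * (4 * n) * r - 1) * J(((7 * (4 * n) * r - 1 : ℕ) : ℤ) | r) = 1)
    (S₂ : ℤ) (hS₂ : ∑ j ∈ Finset.range (7 * (4 * n) * r), (f j * J((j : ℤ) | r)) * (j : ℤ) ^ (7 + 1) = S₂)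
    (h1₂ : (7 : ℤ) ∣ S₂) (h2₂ : ¬ (7 : ℤ) ^ 2 ∣ S₂)
    (h120 : KrizLi2019.thm120_padicLogHeegner_unit_of_bernoulli) (hnf : exists_isNewformOf)
    (hGZ : ∀ (N : ℕ) [NeZero N] (V : WeierstrassCurve ℚ) (L : Type) [Field L] [NumberField L], gross_zagier N V L)
    (hHP : ∀ (V : WeierstrassCurve ℚ) (L : Type) [Field L] [NumberField L], exists_isHeegnerPoint V L)
    (hpar : ∀ (V : WeierstrassCurve ℚ) [V.IsElliptic], p_parity V 2)
    (W : WeierstrassCurve ℚ) [W.IsElliptic] [W.IsGloballyMinimal]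
    (hW : ∃ C : VariableChange ℚ, C • W = cm7.quadraticTwist ((-(4 * (n : ℤ)) : ℤ) : ℚ))
    (hco : W.selmerCorank 2 = 1) : W.analyticRank = 1 :=
  haveI : NeZero r := ⟨hr.out.ne_zero⟩
  rankOneTwoConverse_twist_cm7_even_of_thm120 hn4 hsq h7n hr8 hr7 hrn h7split hsplit
    (hcert₁_twist_of_sum f hf hlev₁ hlast₁ S₁ hS₁ h1₁ h2₁)
    (hcert₂_twist_of_sum f hf hlev₂ hlast₂ S₂ hS₂ h1₂ h2₂) h120 hnf hGZ hHP hpar W hW hco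

end Summit.BirchSwinnertonDyer.BirchSwinnertonDyer.Theorems.GoldfeldGoodTwists

end
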